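import Literature.AnabelianGeometry.EtaleTheta.Discharge.Sec2InnerInducesOnTheta
import Literature.AnabelianGeometry.EtaleTheta.Discharge.Sec2Cor28iiiInnerOfEmbedding
import Literature.IUT.HodgeArakelov.EtaleThetaDataOfSettingRootHypOfCor28iIntrinsicStable
import HarnessLib

/-!
# [EtTh] Cor 2.8 (i): INSTANCE FORMS of the relation «`γ` induces `Γ_Θ` on the cyclotome `Δ_Θ = top/bot`»
# (FACT-LIST row F-0643 `ThetaOrbitData.InducesOnTheta`)

S. Mochizuki, *The étale theta function and its Frobenioid-theoretic manifestations* [EtTh], Publ. RIMS **45**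
(2009) (refereed), §2, Cor 2.8, PRIMS PDF p.41 (last lines) – p.42 (printed pp.267–268; own render
`paper:doi-10-2977-prims-1234361159` p0041/p0042): «Let `γ : Π^tp_{X̲̲α} ⥲ Π^tp_{X̲̲β}` (respectively, …;
`γ : Π^tp_{C̲α} ⥲ Π^tp_{C̲β}`) be an isomorphism of topological groups. Then: (i) The isomorphism `γ` preserves the
property … be of standard type — a property that determines this collection of classes up to multiplication by a root
of unity of order `l` (respectively, 1; `l`; 1)»; «(iii) If the data for `□ = α, β` are equal, and `γ` arises
[cf. Proposition 2.6] from an inner automorphism of `Π^tp_Ẋ̲̲` …»; proof (p.42): «First, let us recall the characteristic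
nature of the various coverings involved [cf. Propositions 2.4, 2.6]. Now assertion (i) follows immediately from
Theorem 1.10, (i), and the definitions» (bib key `MochizukiEtTh2009`).  The RELATION `InducesOnTheta Γ Γ_Θ` («`Γ`
induces `Γ_Θ` on the cyclotome») is abc-iut-L2-t2's TYPING of how such a `γ` acts on the coefficients `Δ_Θ`, presented
in `ThetaRootOrbits.lean` as the subquotient `top/bot` of `Π^tp_C` (print's mechanism: proof of Prop 2.4, p.39, «`γ`
induces an isomorphism `Π^tp_{Cα} ⥲ Π^tp_{Cβ}` which … induces an isomorphism `Δ^tp_{Xα} ⥲ Δ^tp_{Xβ}`, hence also [by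
considering the conjugation action of `Π^tp_C` on an appropriate abelian quotient of `Δ^tp_X` …] an isomorphism
`Π^tp_{Xα} ⥲ Π^tp_{Xβ}`»); it is a typed reading, not a printed sentence.  (Docstring v2: v1 of this header carried a
paraphrase in quotation marks — «… may be characterized as a subquotient of `Π^tp_C` … induces an automorphism of
`Δ_Θ`» — that is NOT verbatim print; corrected here, declarations unchanged.)

PROOF-ONLY companion (0 `def`, 0 `instance`, 0 notation, no new `Prop`; cell abc-iut, block F, seat abc-iut-f-193
gen 13, KEY F0643; row **F-0643**, node EtTh:Cor2.8(i)).  The universal closure `∀ O Γ Γ_Θ, InducesOnTheta Γ Γ_Θ` of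
abc-iut-L2-t2's RELATION is refuted (abc-iut-w4-d051's `ThetaOrbitData.not_forall_inducesOnTheta`, witness
`(id, inversion)`); its content is the instance form «for the `γ` of Cor 2.8 there IS (exactly one) induced `Γ_Θ`».
The tree holds that content as `∃`-statements (abc-iut-L2-t2's `exists_inducesOnTheta_innerAutTop`, abc-iut-w6-d051's
`exists_inducesOnTheta_of_map_eq` / `inducesOnTheta_iff_map_eq`, abc-iut-f-152's `InducesOnTheta.unique`).  HERE, by
name over those, the HEAD-FORM instances (conclusion literally `InducesOnTheta Γ Γ_Θ`, `Γ_Θ` explicit):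
* `inducesOnTheta_innerAutTop` — for EVERY orbit datum `O` and EVERY `x ∈ Π^tp_C`, the inner automorphism `γ_x`
  induces the conjugation action `act x` (packaged as a `MulEquiv`); `inducesOnTheta_innerAutTop_iff` — and nothing
  else; `existsUnique_inducesOnTheta_innerAutTop`;
* `inducesOnTheta_refl_iff` — the refuter's family DECIDED: `(id, Γ_Θ)` is an induced pair iff `Γ_Θ = 1`;
* `existsUnique_inducesOnTheta_iff_map_eq` — general `Γ ∈ Aut_top(Π^tp_C)`: `∃! Γ_Θ` iff `Γ(top) = top ∧ Γ(bot) = bot`;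
* `ofEmbedding_inducesOnTheta_innerAutTop` — the instance at the carrier of the cone's binder site (abc-iut-c312-2
  CONE-FACT-SURGERY: `OrbitEmbedding.symm_coeffOf_of_induces`, binder #13
  `h : (ofEmbedding ε hC hS).InducesOnTheta (innerAutTop (ε.ι σ)) Γ_Θ`), and `OrbitEmbedding.symm_coeffOf_innerAutTop` —
  that site RE-CLOSED: its conclusion for the induced `Γ_Θ`, with NO `InducesOnTheta` binder.
HONEST FRAMING: statements about the TYPED interface; [EtTh] is refereed and nothing of it is asserted beyond the
displayed statements; no side is taken on [IUTchIII] Cor 3.12; typed ≠ proved; nothing here bears on abc itself.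
-/

noncomputable section

namespace Literature.AnabelianGeometry.EtaleTheta

open ThetaCovers

universe u

namespace ThetaCovers.ThetaOrbitData

section generic

variable {l : ℕ} {T : TemperedCoverData.{u} l} (O : ThetaOrbitData T)

/-- **F-0643, instance form (inner case, head form)**: for every orbit datum `O` and every `x ∈ Π^tp_C`, the
inner automorphism `γ_x` INDUCES on `Δ_Θ = top/bot` the conjugation action `act x` (as a group automorphism with
inverse `act x⁻¹`). [cite: MochizukiEtTh2009, Cor 2.8(i) p.42] -/
theorem inducesOnTheta_innerAutTop (x : T.Gtp) :
    O.InducesOnTheta (innerAutTop x)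
      (MulEquiv.mk' ⟨O.act x, O.act x⁻¹, O.act_inv_act x, O.act_act_inv x⟩ (map_mul (O.act x))) := by
  haveI := O.top_normal
  exact ⟨map_innerAutTop_eq_of_normal O.top x, fun _ => rfl⟩

/-- **… and nothing else**: `Γ_Θ` is induced by `γ_x` iff `Γ_Θ = act x` pointwise.
[cite: MochizukiEtTh2009, Cor 2.8(i) p.42] -/
theorem inducesOnTheta_innerAutTop_iff (x : T.Gtp) (ΓΘ : O.DeltaTheta ≃* O.DeltaTheta) :
    O.InducesOnTheta (innerAutTop x) ΓΘ ↔ ∀ a, ΓΘ a = O.act x a := by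
  refine ⟨fun h => O.inducesOnTheta_innerAutTop_eq_act h, fun h => ?_⟩
  have hΓ : ΓΘ = MulEquiv.mk' ⟨O.act x, O.act x⁻¹, O.act_inv_act x, O.act_act_inv x⟩ (map_mul (O.act x)) :=
    MulEquiv.ext fun a => h a
  rw [hΓ]
  exact O.inducesOnTheta_innerAutTop x

/-- **Existence and uniqueness, inner case**: exactly one `Γ_Θ` is induced by `γ_x`.
[cite: MochizukiEtTh2009, Cor 2.8(i) p.42] -/
theorem existsUnique_inducesOnTheta_innerAutTop (x : T.Gtp) :
    ∃! ΓΘ : O.DeltaTheta ≃* O.DeltaTheta, O.InducesOnTheta (innerAutTop x) ΓΘ :=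
  ⟨_, O.inducesOnTheta_innerAutTop x, fun _ h => h.unique (O.inducesOnTheta_innerAutTop x)⟩

/-- **The refuter's family decided**: the identity of `Π^tp_C` induces `Γ_Θ` iff `Γ_Θ = 1` — so abc-iut-w4-d051's
closure witness `(id, inversion)` fails exactly because inversion `≠ 1` there, and `(id, 1)` is the surviving
instance (abc-iut-f-152's `inducesOnTheta_refl` + `InducesOnTheta.unique`). [cite: MochizukiEtTh2009, Cor 2.8(i) p.42] -/
theorem inducesOnTheta_refl_iff (ΓΘ : O.DeltaTheta ≃* O.DeltaTheta) :
    O.InducesOnTheta (ContinuousMulEquiv.refl T.Gtp) ΓΘ ↔ ΓΘ = MulEquiv.refl O.DeltaTheta := by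
  refine ⟨fun h => h.unique O.inducesOnTheta_refl, ?_⟩
  rintro rfl
  exact O.inducesOnTheta_refl

/-- **General `γ ∈ Aut_top(Π^tp_C)`**: there is EXACTLY ONE induced `Γ_Θ` iff `γ` stabilises `top` and `bot`
(abc-iut-w6-d051's `inducesOnTheta_iff_map_eq` + abc-iut-f-152's `InducesOnTheta.unique`) — the typed reading of
«the characteristic nature of the various coverings involved [cf. Propositions 2.4, 2.6]» for the subquotient
`Δ_Θ = top/bot`. [cite: MochizukiEtTh2009, Cor 2.8(i) p.42] -/
theorem existsUnique_inducesOnTheta_iff_map_eq (Γ : T.Gtp ≃ₜ* T.Gtp) :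
    (∃! ΓΘ : O.DeltaTheta ≃* O.DeltaTheta, O.InducesOnTheta Γ ΓΘ) ↔
      O.top.map Γ.toMulEquiv.toMonoidHom = O.top ∧ O.bot.map Γ.toMulEquiv.toMonoidHom = O.bot := by
  rw [← O.inducesOnTheta_iff_map_eq Γ]
  exact ⟨fun h => h.exists, fun ⟨ΓΘ, h⟩ => ⟨ΓΘ, h, fun _ h' => h'.unique h⟩⟩

end generic

/-! ### At the §1-model orbit datum `ofEmbedding ε hC hS` (the carrier of the cone's binder site) -/

variable {p : ℕ} [Fact p.Prime] {D : ThetaSetting p} {E : D.EtaleThetaData} {l : ℕ}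
  {C : E.DoubleUnderline l} {T : TemperedCoverData.{u} l} (ε : C.OrbitEmbedding T)

/-- **F-0643 at the cone's binder site** (abc-iut-c312-2 CONE-FACT-SURGERY, `OrbitEmbedding.symm_coeffOf_of_induces`
#13 `h : (ofEmbedding ε hC hS).InducesOnTheta (innerAutTop (ε.ι σ)) Γ_Θ`; take `x := ε.ι σ`): for every
`x ∈ Π^tp_C` of `T`, `γ_x` induces `act x` on the cyclotome `ι(toTheta⁻¹Δ_Θ)/ι(Ker toTheta)` of abc-iut-L2-t2's
`ofEmbedding`. [cite: MochizukiEtTh2009, Cor 2.8(i) p.42] -/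
theorem ofEmbedding_inducesOnTheta_innerAutTop (hC : D.Compat) (hS : D.Sec2Hyps) (x : T.Gtp) :
    (ofEmbedding ε hC hS).InducesOnTheta (innerAutTop x)
      (MulEquiv.mk' ⟨(ofEmbedding ε hC hS).act x, (ofEmbedding ε hC hS).act x⁻¹,
        (ofEmbedding ε hC hS).act_inv_act x, (ofEmbedding ε hC hS).act_act_inv x⟩
        (map_mul ((ofEmbedding ε hC hS).act x))) :=
  (ofEmbedding ε hC hS).inducesOnTheta_innerAutTop x

end ThetaCovers.ThetaOrbitData

namespace ThetaSetting.EtaleThetaData.DoubleUnderline.OrbitEmbedding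

variable {p : ℕ} [Fact p.Prime] {D : ThetaSetting p} {E : D.EtaleThetaData} {l : ℕ}
  {C : E.DoubleUnderline l} {T : TemperedCoverData.{u} l} (ε : C.OrbitEmbedding T)

/-- **The binder site RE-CLOSED**: the conclusion of abc-iut-w4-d041's `symm_coeffOf_of_induces` — `Γ_Θ⁻¹` is
conjugation by `toTheta(σ)⁻¹` on `Δ_Θ` — for THE `Γ_Θ` induced by `γ_{ι σ}` (`= act (ι σ)`), with NO `InducesOnTheta`
hypothesis. [cite: MochizukiEtTh2009, Cor 2.8(i) p.42] -/
theorem symm_coeffOf_innerAutTop (hC : D.Compat) (hS : D.Sec2Hyps) (σ : D.PiTemp) (d : ↥D.DeltaTheta) :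
    (MulEquiv.mk' ⟨(ThetaOrbitData.ofEmbedding ε hC hS).act (ε.ι σ),
        (ThetaOrbitData.ofEmbedding ε hC hS).act (ε.ι σ)⁻¹,
        (ThetaOrbitData.ofEmbedding ε hC hS).act_inv_act (ε.ι σ),
        (ThetaOrbitData.ofEmbedding ε hC hS).act_act_inv (ε.ι σ)⟩
        (map_mul ((ThetaOrbitData.ofEmbedding ε hC hS).act (ε.ι σ)))).symm (ε.coeffOf d) =
      ε.coeffOf (MulAut.conjNormal (D.toTheta σ⁻¹) d) := by
  haveI : ε.bot.Normal := ε.normal_bot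
  exact ε.symm_coeffOf_of_induces hC hS σ _
    (ThetaOrbitData.ofEmbedding_inducesOnTheta_innerAutTop ε hC hS (ε.ι σ)) d

end ThetaSetting.EtaleThetaData.DoubleUnderline.OrbitEmbedding

end Literature.AnabelianGeometry.EtaleTheta

end
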